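import Literature.NumberTheory.Weil1965.RealQuadraticFormFibreDensity
import Mathlib.Analysis.Distribution.AEEqOfIntegralContDiff
import Mathlib.Analysis.Calculus.BumpFunction.Normed
import Mathlib.Analysis.Calculus.BumpFunction.FiniteDimension
import Mathlib.Analysis.SpecialFunctions.ImproperIntegrals
import HarnessLib

/-!
# Fibre densities of a non-degenerate real quadratic form, II: uniqueness and the transformation laws

Topic `NumberTheory/Weil1965`; namespace `Literature.NumberTheory.Weil1965`. KERNEL mathematics only (theorems;
no definition, no named fact, no `axiom`, no `sorry`). Sequel of `RealQuadraticFormFibreDensity.lean`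
(`F*_Φ = quadGaussTransform d Φ`, `F_Φ = quadFibreDensity d Φ = 𝓕 F*_Φ`, and the push-forward identity
`∫ Φ (g ∘ q_d) = ∫ F_Φ g` for `Φ ∈ L¹`, `F*_Φ ∈ L¹`).

All statements are under Weil's condition (A) «`F*_Φ ∈ L¹(ℝ)`» (hypothesis `hG`), discharged for Schwartz `Φ`
and `n ≥ 3` in `RealQuadraticFormFibreDensityDecay.lean`.
* §1 substitution formulas for `F*_Φ`: complex conjugation, dilation `Φ(s·)`, coefficient scaling `q_{c d}`,
  multiplication by the form.
* §2 UNIQUENESS (`quadFibreDensity_unique`): a continuous `F` with `∫ Φ (g ∘ q_d) = ∫ F g` for all smooth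
  compactly supported real `g` IS `F_Φ` — Weil's «la mesure tempérée déterminée par `|θ_i|`» is determined by
  its values on test functions [Weil1965, Chap. I n° 6; Chap. III n° 37 (29)].
* §3 the LAWS, each by uniqueness: reality `conj F_Φ = F_{conj Φ}` (`quadFibreDensity_conj`), POSITIVITY
  `F_Φ ≥ 0` for `Φ ≥ 0` (`quadFibreDensity_re_nonneg`: `|θ_b|` is a positive measure), DILATION
  `F_{Φ(s·)}(b) = |s|^{-n} s² F_Φ(s² b)` (`quadFibreDensity_comp_smul`), COEFFICIENT SCALING
  `F^{c d}_Φ(b) = |c|⁻¹ F^{d}_Φ(b/c)` (`quadFibreDensity_smul_coeff`), MULTIPLICATION `b F_Φ(b) = F_{q_d Φ}(b)`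
  (`ofReal_mul_quadFibreDensity`) — whence the decay `|b| ‖F_Φ(b)‖ ≤ ‖F*_{q_d Φ}‖₁`.
* §4 the FOURIER PAIR [Weil1965, Chap. III n° 37 Prop. 6: «transformées de Fourier l'une de l'autre»]: if also
  `F_Φ ∈ L¹` then `𝓕⁻ F_Φ = F*_Φ` (`fourierInv_quadFibreDensity`) and `∫ F_Φ = F*_Φ(0) = ∫ Φ`
  (`integral_quadFibreDensity`: «en particulier `∫ Φ dx = ∫ F_Φ di`»).

## References
* [Weil1965] A. Weil, *Sur la formule de Siegel dans la théorie des groupes classiques*, Acta Math. 113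
  (1965) 1–87: Chap. I n° 1–2, 6; Chap. III n° 37, Prop. 6, p. 54.
* [Weil1964] A. Weil, *Sur certains groupes d'opérateurs unitaires*, Acta Math. 111 (1964): Chap. II n° 26.
-/

set_option autoImplicit false

noncomputable section

open MeasureTheory Complex Filter Topology Set Finset
open scoped Real FourierTransform SchwartzMap BigOperators ComplexConjugate RealInnerProductSpace ContDiff

namespace Literature.NumberTheory.Weil1965

variable {ι : Type*} [Fintype ι]

/-! ## §1 Substitution formulas for `F*_Φ` -/

/-- `conj e(t q) = e(-t q)`. [cite: Weil1965, Chap. I n° 1 (1), p. 3] -/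
theorem conj_quadChar (d : ι → ℝ) (t : ℝ) (v : EuclideanSpace ℝ ι) :
    conj (quadChar d t v) = quadChar d (-t) v := by
  rw [quadChar_apply, quadChar_apply, ← Complex.exp_conj]
  congr 1
  simp only [map_mul, map_ofNat, Complex.conj_ofReal, Complex.conj_I]
  push_cast
  ring

/-- `F*_{conj Φ}(t) = conj F*_Φ(-t)`. [cite: Weil1965, Chap. I n° 1 (1), p. 3] -/
theorem quadGaussTransform_conj (d : ι → ℝ) (Φ : EuclideanSpace ℝ ι → ℂ) (t : ℝ) :
    quadGaussTransform d (fun v => conj (Φ v)) t = conj (quadGaussTransform d Φ (-t)) := by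
  rw [quadGaussTransform_apply, quadGaussTransform_apply, ← integral_conj]
  congr 1 with v
  rw [map_mul, conj_quadChar, neg_neg]

/-- (A) is stable under conjugation: `F*_{conj Φ} ∈ L¹`. [cite: Weil1965, Chap. I n° 1 (1), p. 3] -/
theorem integrable_quadGaussTransform_conj (d : ι → ℝ) {Φ : EuclideanSpace ℝ ι → ℂ}
    (hG : Integrable (quadGaussTransform d Φ)) : Integrable (quadGaussTransform d fun v => conj (Φ v)) := by
  have h : (quadGaussTransform d fun v => conj (Φ v)) = fun t => conj (quadGaussTransform d Φ (-t)) :=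
    funext (quadGaussTransform_conj d Φ)
  rw [h]
  exact (Complex.conjLIE.toContinuousLinearEquiv.toContinuousLinearMap.integrable_comp hG.comp_neg :)

/-- `q_{c d}`: `F*^{c d}_Φ(t) = F*^{d}_Φ(c t)`. [cite: Weil1965, Chap. I n° 1 (1), p. 3] -/
theorem quadGaussTransform_smul_coeff (c : ℝ) (d : ι → ℝ) (Φ : EuclideanSpace ℝ ι → ℂ) (t : ℝ) :
    quadGaussTransform (c • d) Φ t = quadGaussTransform d Φ (c * t) := by
  rw [quadGaussTransform_apply, quadGaussTransform_apply]
  congr 1 with v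
  rw [quadChar_apply, quadChar_apply, quadFormDiag_smul, ← mul_assoc, mul_comm t c]

/-- DILATION: `F*_{Φ(s·)}(t) = |s|^{-n} F*_Φ(t/s²)` (`s ≠ 0`, `n = dim V`).
[cite: Weil1965, Chap. I n° 1 (1), p. 3] -/
theorem quadGaussTransform_comp_smul (d : ι → ℝ) (Φ : EuclideanSpace ℝ ι → ℂ) {s : ℝ} (hs : s ≠ 0) (t : ℝ) :
    quadGaussTransform d (fun v => Φ (s • v)) t =
      ((|(s ^ Fintype.card ι)⁻¹| : ℝ) : ℂ) * quadGaussTransform d Φ (t / s ^ 2) := by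
  rw [quadGaussTransform_apply, quadGaussTransform_apply]
  have h : ∀ v : EuclideanSpace ℝ ι, Φ (s • v) * quadChar d t v =
      (fun w => Φ w * quadChar d (t / s ^ 2) w) (s • v) := fun v => by
    have hr : t / s ^ 2 * (s ^ 2 * quadFormDiag d v) = t * quadFormDiag d v := by field_simp
    simp only [quadChar_apply, quadFormDiag_smul_left, hr]
  simp_rw [h]
  rw [Measure.integral_comp_smul volume (fun w => Φ w * quadChar d (t / s ^ 2) w) s, finrank_euclideanSpace]
  rw [Complex.real_smul]

/-- (A) is stable under dilation. [cite: Weil1965, Chap. I n° 1 (1), p. 3] -/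
theorem integrable_quadGaussTransform_comp_smul (d : ι → ℝ) {Φ : EuclideanSpace ℝ ι → ℂ}
    (hG : Integrable (quadGaussTransform d Φ)) {s : ℝ} (hs : s ≠ 0) :
    Integrable (quadGaussTransform d fun v => Φ (s • v)) := by
  have h : (quadGaussTransform d fun v => Φ (s • v)) =
      fun t => ((|(s ^ Fintype.card ι)⁻¹| : ℝ) : ℂ) * quadGaussTransform d Φ (t / s ^ 2) :=
    funext (quadGaussTransform_comp_smul d Φ hs)
  rw [h]
  exact (hG.comp_div (pow_ne_zero 2 hs)).const_mul _

/-- (A) is stable under coefficient scaling. [cite: Weil1965, Chap. I n° 1 (1), p. 3] -/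
theorem integrable_quadGaussTransform_smul_coeff (d : ι → ℝ) {Φ : EuclideanSpace ℝ ι → ℂ}
    (hG : Integrable (quadGaussTransform d Φ)) {c : ℝ} (hc : c ≠ 0) :
    Integrable (quadGaussTransform (c • d) Φ) := by
  have h : quadGaussTransform (c • d) Φ = fun t => quadGaussTransform d Φ (c * t) :=
    funext (quadGaussTransform_smul_coeff c d Φ)
  rw [h]
  exact hG.comp_mul_left' hc

/-! ## §2 Uniqueness of the fibre density -/

/-- a product of a continuous function with a continuous compactly supported weight is integrable.
[folklore] -/
private theorem integrable_mul_ofReal_of_hasCompactSupport {F : ℝ → ℂ} (hF : Continuous F) {g : ℝ → ℝ}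
    (hg : Continuous g) (hgs : HasCompactSupport g) : Integrable fun b => F b * (g b : ℂ) := by
  refine Continuous.integrable_of_hasCompactSupport (hF.mul (Complex.continuous_ofReal.comp hg)) ?_
  exact (hgs.comp_left Complex.ofReal_zero).mul_left

/-- **Uniqueness of the fibre density**: a continuous `F : ℝ → ℂ` such that
`∫ Φ(v) g(q_d(v)) dv = ∫ F(b) g(b) db` for every smooth compactly supported real `g` is `F_Φ` — the
tempered measure `|θ_i|` is determined by its values on test functions, and `F_Φ` is its continuous density.
[cite: Weil1965, Chap. I n° 6, p. 12; Chap. III n° 37 Prop. 6, p. 54] -/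
theorem quadFibreDensity_unique (d : ι → ℝ) {Φ : EuclideanSpace ℝ ι → ℂ} (hΦ : Integrable Φ)
    (hG : Integrable (quadGaussTransform d Φ)) {F : ℝ → ℂ} (hF : Continuous F)
    (h : ∀ g : ℝ → ℝ, ContDiff ℝ ∞ g → HasCompactSupport g →
      ∫ v, Φ v * (g (quadFormDiag d v) : ℂ) = ∫ b, F b * (g b : ℂ)) :
    F = quadFibreDensity d Φ := by
  have hFc := continuous_quadFibreDensity d hG
  set H : ℝ → ℂ := fun b => F b - quadFibreDensity d Φ b with hH
  have hHc : Continuous H := hF.sub hFc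
  have hae : ∀ᵐ b ∂(volume : Measure ℝ), H b = 0 := by
    refine ae_eq_zero_of_integral_contDiff_smul_eq_zero hHc.locallyIntegrable fun g hg hgs => ?_
    have h1 := h g hg hgs
    have h2 := integral_mul_comp_quadFormDiag_smooth d hΦ hG hg hgs
    have hi1 := integrable_mul_ofReal_of_hasCompactSupport hF hg.continuous hgs
    have hi2 := integrable_mul_ofReal_of_hasCompactSupport hFc hg.continuous hgs
    calc ∫ b, g b • H b = ∫ b, (F b * (g b : ℂ) - quadFibreDensity d Φ b * (g b : ℂ)) := by
          congr 1 with b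
          rw [hH, Complex.real_smul]
          ring
      _ = 0 := by rw [integral_sub hi1 hi2, ← h1, ← h2, sub_self]
  have hH0 : H = 0 := (hHc.ae_eq_iff_eq volume continuous_const).1 hae
  funext b
  have := congrFun hH0 b
  rw [hH, Pi.zero_apply, sub_eq_zero] at this
  exact this

/-! ## §3 The laws: reality, positivity, dilation, coefficient scaling, multiplication by the form -/

/-- REALITY: `conj F_Φ = F_{conj Φ}`; in particular `F_Φ` is real-valued for real `Φ`.
[cite: Weil1965, Chap. III n° 37 Prop. 6, p. 54] -/
theorem quadFibreDensity_conj (d : ι → ℝ) {Φ : EuclideanSpace ℝ ι → ℂ} (hΦ : Integrable Φ)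
    (hG : Integrable (quadGaussTransform d Φ)) (b : ℝ) :
    conj (quadFibreDensity d Φ b) = quadFibreDensity d (fun v => conj (Φ v)) b := by
  have hΦ' : Integrable fun v => conj (Φ v) :=
    (Complex.conjLIE.toContinuousLinearEquiv.toContinuousLinearMap.integrable_comp hΦ :)
  have key := quadFibreDensity_unique d hΦ' (integrable_quadGaussTransform_conj d hG)
    (F := fun b => conj (quadFibreDensity d Φ b))
    (Complex.continuous_conj.comp (continuous_quadFibreDensity d hG)) fun g hg hgs => by
      have h2 := integral_mul_comp_quadFormDiag_smooth d hΦ hG hg hgs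
      calc ∫ v, conj (Φ v) * (g (quadFormDiag d v) : ℂ)
          = conj (∫ v, Φ v * (g (quadFormDiag d v) : ℂ)) := by
            rw [← integral_conj]; congr 1 with v; simp
        _ = ∫ b, conj (quadFibreDensity d Φ b) * (g b : ℂ) := by
            rw [h2, ← integral_conj]; congr 1 with b; simp
  exact congrFun key b

/-- POSITIVITY: for a non-negative (real) `Φ`, `F_Φ(b)` is a non-negative real for EVERY `b` — `|θ_b|` is a
positive measure, and its density is continuous. [cite: Weil1965, Chap. I n° 6, p. 12; Chap. III n° 37, p. 54] -/
theorem quadFibreDensity_re_nonneg (d : ι → ℝ) {Φ₀ : EuclideanSpace ℝ ι → ℝ} (hΦ₀ : ∀ v, 0 ≤ Φ₀ v)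
    (hΦ : Integrable fun v => (Φ₀ v : ℂ)) (hG : Integrable (quadGaussTransform d fun v => (Φ₀ v : ℂ)))
    (b : ℝ) :
    0 ≤ (quadFibreDensity d (fun v => (Φ₀ v : ℂ)) b).re ∧
      (quadFibreDensity d (fun v => (Φ₀ v : ℂ)) b).im = 0 := by
  set F := quadFibreDensity d (fun v => (Φ₀ v : ℂ)) with hFdef
  have hFc : Continuous F := continuous_quadFibreDensity d hG
  -- reality
  have hreal : ∀ b, (F b).im = 0 := fun b => by
    have h := quadFibreDensity_conj d hΦ hG b
    simp only [Complex.conj_ofReal] at h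
    rw [← hFdef] at h
    have := congrArg Complex.im h
    rw [Complex.conj_im] at this
    linarith
  refine ⟨?_, hreal b⟩
  -- positivity by a bump test at a point where `re F < 0`
  by_contra hneg
  push Not at hneg
  obtain ⟨δ, hδ, hball⟩ : ∃ δ > 0, ∀ c, dist c b < δ → (F c).re < (F b).re / 2 := by
    have hc : ContinuousAt (fun c => (F c).re) b := (Complex.continuous_re.comp hFc).continuousAt
    have := hc.eventually (gt_mem_nhds (show (F b).re < (F b).re / 2 by linarith))
    obtain ⟨δ, hδ, h⟩ := Metric.eventually_nhds_iff.1 this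
    exact ⟨δ, hδ, fun c hc => h hc⟩
  let φ : ContDiffBump b := ⟨δ / 4, δ / 2, by positivity, by linarith⟩
  have hφs : HasCompactSupport (φ : ℝ → ℝ) := φ.hasCompactSupport
  have hφd : ContDiff ℝ ∞ (φ : ℝ → ℝ) := φ.contDiff
  have hpush := integral_mul_comp_quadFormDiag_smooth d hΦ hG hφd hφs
  -- left side has non-negative real part
  have hL : 0 ≤ (∫ v, (Φ₀ v : ℂ) * ((φ : ℝ → ℝ) (quadFormDiag d v) : ℂ)).re := by
    have hfun : (fun v => (Φ₀ v : ℂ) * ((φ : ℝ → ℝ) (quadFormDiag d v) : ℂ)) =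
        fun v => ((Φ₀ v * (φ : ℝ → ℝ) (quadFormDiag d v) : ℝ) : ℂ) := by
      funext v; push_cast; ring
    rw [hfun, integral_complex_ofReal, Complex.ofReal_re]
    exact integral_nonneg fun v => mul_nonneg (hΦ₀ v) φ.nonneg
  -- right side has negative real part
  have hR : (∫ c, F c * ((φ : ℝ → ℝ) c : ℂ)).re < 0 := by
    have hint : Integrable fun c => F c * ((φ : ℝ → ℝ) c : ℂ) :=
      integrable_mul_ofReal_of_hasCompactSupport hFc φ.continuous hφs
    have hre : (∫ c, F c * ((φ : ℝ → ℝ) c : ℂ)).re = ∫ c, (F c).re * (φ : ℝ → ℝ) c := by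
      rw [← Complex.reCLM_apply, ← ContinuousLinearMap.integral_comp_comm _ hint]
      congr 1 with c
      simp [hreal c]
    rw [hre]
    have hle : ∀ c, (F c).re * (φ : ℝ → ℝ) c ≤ (F b).re / 2 * (φ : ℝ → ℝ) c := fun c => by
      by_cases hc : dist c b < δ
      · exact mul_le_mul_of_nonneg_right (hball c hc).le φ.nonneg
      · have : (φ : ℝ → ℝ) c = 0 := by
          apply φ.zero_of_le_dist
          push Not at hc
          exact le_trans (by show φ.rOut ≤ δ; exact le_of_lt (by show δ / 2 < δ; linarith)) hc
        simp [this]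
    have hφi : Integrable (φ : ℝ → ℝ) := φ.integrable
    have hfi : Integrable fun c => (F c).re * (φ : ℝ → ℝ) c :=
      Continuous.integrable_of_hasCompactSupport ((Complex.continuous_re.comp hFc).mul φ.continuous)
        hφs.mul_left
    calc ∫ c, (F c).re * (φ : ℝ → ℝ) c ≤ ∫ c, (F b).re / 2 * (φ : ℝ → ℝ) c :=
          integral_mono hfi (hφi.const_mul _) hle
      _ = (F b).re / 2 * ∫ c, (φ : ℝ → ℝ) c := integral_const_mul _ _
      _ < 0 := mul_neg_of_neg_of_pos (by linarith) φ.integral_pos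
  rw [hpush] at hL
  exact absurd hR (not_lt.2 hL)

/-- a smooth compactly supported real weight composed with `b ↦ a b` (`a ≠ 0`) is again one. [folklore] -/
private theorem test_comp_mul {g : ℝ → ℝ} (hg : ContDiff ℝ ∞ g) (hgs : HasCompactSupport g) {a : ℝ}
    (ha : a ≠ 0) : ContDiff ℝ ∞ (fun b => g (a * b)) ∧ HasCompactSupport fun b => g (a * b) := by
  refine ⟨hg.comp (contDiff_const.mul contDiff_id), ?_⟩
  have h := hgs.comp_homeomorph (Homeomorph.mulLeft₀ a ha)
  rwa [Homeomorph.coe_mulLeft₀] at h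

/-- a smooth compactly supported real weight times `b` is again one. [folklore] -/
private theorem test_mul_id {g : ℝ → ℝ} (hg : ContDiff ℝ ∞ g) (hgs : HasCompactSupport g) :
    ContDiff ℝ ∞ (fun b => b * g b) ∧ HasCompactSupport fun b => b * g b :=
  ⟨contDiff_id.mul hg, hgs.mul_left⟩

/-- DILATION LAW: `F_{Φ(s·)}(b) = |s|^{-n} s² F_Φ(s² b)` for `s ≠ 0` (`n = dim V`): the module of `v ↦ s v` on
`ℝ^ι` is `|s|^n` and `q_d(s v) = s² q_d(v)`. [cite: Weil1965, Chap. I n° 6, p. 12; Chap. III n° 37 (29), p. 54] -/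
theorem quadFibreDensity_comp_smul (d : ι → ℝ) {Φ : EuclideanSpace ℝ ι → ℂ} (hΦ : Integrable Φ)
    (hG : Integrable (quadGaussTransform d Φ)) {s : ℝ} (hs : s ≠ 0) (b : ℝ) :
    quadFibreDensity d (fun v => Φ (s • v)) b =
      ((|(s ^ Fintype.card ι)⁻¹| * s ^ 2 : ℝ) : ℂ) * quadFibreDensity d Φ (s ^ 2 * b) := by
  have hs2 : s ^ 2 ≠ 0 := pow_ne_zero 2 hs
  have hFc := continuous_quadFibreDensity d hG
  refine (congrFun (quadFibreDensity_unique d (hΦ.comp_smul hs) (integrable_quadGaussTransform_comp_smul d hG hs)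
    (F := fun b => ((|(s ^ Fintype.card ι)⁻¹| * s ^ 2 : ℝ) : ℂ) * quadFibreDensity d Φ (s ^ 2 * b))
    (continuous_const.mul (hFc.comp (continuous_const.mul continuous_id))) fun g hg hgs => ?_) b).symm
  obtain ⟨hg', hgs'⟩ := test_comp_mul hg hgs (inv_ne_zero hs2)
  -- (1) change of variables `w = s v` on `V`
  have h1 : ∫ v, Φ (s • v) * (g (quadFormDiag d v) : ℂ) =
      |(s ^ Fintype.card ι)⁻¹| • ∫ w, Φ w * (g ((s ^ 2)⁻¹ * quadFormDiag d w) : ℂ) := by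
    set G : EuclideanSpace ℝ ι → ℂ := fun w => Φ w * (g ((s ^ 2)⁻¹ * quadFormDiag d w) : ℂ) with hGdef
    have h : (fun v : EuclideanSpace ℝ ι => Φ (s • v) * (g (quadFormDiag d v) : ℂ)) = fun v => G (s • v) := by
      funext v
      have hr : (s ^ 2)⁻¹ * quadFormDiag d (s • v) = quadFormDiag d v := by
        rw [quadFormDiag_smul_left]; field_simp
      simp only [hGdef, hr]
    rw [h, Measure.integral_comp_smul volume G s, finrank_euclideanSpace]
  -- (2) push-forward for `Φ` with the weight `g((s²)⁻¹ ·)`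
  have h2 : ∫ w, Φ w * (g ((s ^ 2)⁻¹ * quadFormDiag d w) : ℂ) =
      ∫ c, quadFibreDensity d Φ c * (g ((s ^ 2)⁻¹ * c) : ℂ) :=
    integral_mul_comp_quadFormDiag_smooth d hΦ hG hg' hgs'
  -- (3) change of variables `c = s² b` on `ℝ`
  have h3 : ∫ b, quadFibreDensity d Φ (s ^ 2 * b) * (g b : ℂ) =
      |(s ^ 2)⁻¹| • ∫ c, quadFibreDensity d Φ c * (g ((s ^ 2)⁻¹ * c) : ℂ) := by
    set G : ℝ → ℂ := fun c => quadFibreDensity d Φ c * (g ((s ^ 2)⁻¹ * c) : ℂ) with hGdef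
    have h : (fun b : ℝ => quadFibreDensity d Φ (s ^ 2 * b) * (g b : ℂ)) = fun b => G (s ^ 2 * b) := by
      funext b
      have hr : (s ^ 2)⁻¹ * (s ^ 2 * b) = b := by field_simp
      simp only [hGdef, hr]
    rw [h]
    exact Measure.integral_comp_mul_left G (s ^ 2)
  rw [h1, h2]
  calc |(s ^ Fintype.card ι)⁻¹| • ∫ c, quadFibreDensity d Φ c * (g ((s ^ 2)⁻¹ * c) : ℂ)
      = ((|(s ^ Fintype.card ι)⁻¹| * s ^ 2 : ℝ) : ℂ) *
          (|(s ^ 2)⁻¹| • ∫ c, quadFibreDensity d Φ c * (g ((s ^ 2)⁻¹ * c) : ℂ)) := by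
        rw [Complex.real_smul, Complex.real_smul, ← mul_assoc]
        congr 1
        have habs : |(s ^ 2)⁻¹| = (s ^ 2)⁻¹ := abs_of_pos (inv_pos.2 (by positivity))
        rw [habs, ← Complex.ofReal_mul]
        congr 1
        rw [mul_assoc, mul_inv_cancel₀ hs2, mul_one]
    _ = ∫ b, ((|(s ^ Fintype.card ι)⁻¹| * s ^ 2 : ℝ) : ℂ) * quadFibreDensity d Φ (s ^ 2 * b) * (g b : ℂ) := by
        rw [← h3, ← integral_const_mul]; congr 1 with b; ring

/-- COEFFICIENT SCALING: `F^{c d}_Φ(b) = |c|⁻¹ F^{d}_Φ(b / c)` (`c ≠ 0`) — the fibre `q_{cd} = b` is the fibre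
`q_d = b/c`, and `db` scales by `|c|`. [cite: Weil1965, Chap. I n° 6, p. 12; Chap. III n° 37 (29), p. 54] -/
theorem quadFibreDensity_smul_coeff (d : ι → ℝ) {Φ : EuclideanSpace ℝ ι → ℂ} (hΦ : Integrable Φ)
    (hG : Integrable (quadGaussTransform d Φ)) {c : ℝ} (hc : c ≠ 0) (b : ℝ) :
    quadFibreDensity (c • d) Φ b = ((|c⁻¹| : ℝ) : ℂ) * quadFibreDensity d Φ (c⁻¹ * b) := by
  have hFc := continuous_quadFibreDensity d hG
  refine (congrFun (quadFibreDensity_unique (c • d) hΦ (integrable_quadGaussTransform_smul_coeff d hG hc)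
    (F := fun b => ((|c⁻¹| : ℝ) : ℂ) * quadFibreDensity d Φ (c⁻¹ * b))
    (continuous_const.mul (hFc.comp (continuous_const.mul continuous_id))) fun g hg hgs => ?_) b).symm
  obtain ⟨hg', hgs'⟩ := test_comp_mul hg hgs hc
  have h2 : ∫ v, Φ v * (g (c * quadFormDiag d v) : ℂ) = ∫ b', quadFibreDensity d Φ b' * (g (c * b') : ℂ) :=
    integral_mul_comp_quadFormDiag_smooth d hΦ hG hg' hgs'
  have h3 : ∫ b, quadFibreDensity d Φ (c⁻¹ * b) * (g b : ℂ) =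
      |c| • ∫ b', quadFibreDensity d Φ b' * (g (c * b') : ℂ) := by
    set G : ℝ → ℂ := fun b' => quadFibreDensity d Φ b' * (g (c * b') : ℂ) with hGdef
    have h : (fun b : ℝ => quadFibreDensity d Φ (c⁻¹ * b) * (g b : ℂ)) = fun b => G (c⁻¹ * b) := by
      funext b
      have hr : c * (c⁻¹ * b) = b := by field_simp
      simp only [hGdef, hr]
    rw [h]
    exact Measure.integral_comp_inv_mul_left G c
  simp_rw [quadFormDiag_smul]
  rw [h2]
  calc ∫ b', quadFibreDensity d Φ b' * (g (c * b') : ℂ)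
      = ((|c⁻¹| : ℝ) : ℂ) * (|c| • ∫ b', quadFibreDensity d Φ b' * (g (c * b') : ℂ)) := by
        rw [Complex.real_smul, ← mul_assoc]
        have : ((|c⁻¹| : ℝ) : ℂ) * (|c| : ℝ) = 1 := by
          rw [← Complex.ofReal_mul, abs_inv, inv_mul_cancel₀ (abs_ne_zero.2 hc)]; simp
        rw [this, one_mul]
    _ = ∫ b, ((|c⁻¹| : ℝ) : ℂ) * quadFibreDensity d Φ (c⁻¹ * b) * (g b : ℂ) := by
        rw [← h3, ← integral_const_mul]; congr 1 with b; ring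

/-- MULTIPLICATION BY THE FORM: `b F_Φ(b) = F_{q_d Φ}(b)` — on the fibre `q_d = b` the weight `q_d Φ` is `b Φ`.
[cite: Weil1965, Chap. I n° 6, p. 12; Chap. III n° 37 (29), p. 54] -/
theorem ofReal_mul_quadFibreDensity (d : ι → ℝ) {Φ : EuclideanSpace ℝ ι → ℂ} (hΦ : Integrable Φ)
    (hG : Integrable (quadGaussTransform d Φ))
    (hΦq : Integrable fun v => (quadFormDiag d v : ℂ) * Φ v)
    (hGq : Integrable (quadGaussTransform d fun v => (quadFormDiag d v : ℂ) * Φ v)) (b : ℝ) :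
    (b : ℂ) * quadFibreDensity d Φ b = quadFibreDensity d (fun v => (quadFormDiag d v : ℂ) * Φ v) b := by
  have hFc := continuous_quadFibreDensity d hG
  refine congrFun (quadFibreDensity_unique d hΦq hGq (F := fun b => (b : ℂ) * quadFibreDensity d Φ b)
    ((Complex.continuous_ofReal.comp continuous_id).mul hFc) fun g hg hgs => ?_) b
  obtain ⟨hg', hgs'⟩ := test_mul_id hg hgs
  have h2 := integral_mul_comp_quadFormDiag_smooth d hΦ hG hg' hgs'
  calc ∫ v, (quadFormDiag d v : ℂ) * Φ v * (g (quadFormDiag d v) : ℂ)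
      = ∫ v, Φ v * ((quadFormDiag d v * g (quadFormDiag d v) : ℝ) : ℂ) := by
        congr 1 with v; push_cast; ring
    _ = ∫ b : ℝ, quadFibreDensity d Φ b * ((b * g b : ℝ) : ℂ) := h2
    _ = ∫ b : ℝ, ((b : ℝ) : ℂ) * quadFibreDensity d Φ b * (g b : ℂ) := by
        congr 1 with b; push_cast; ring

/-- DECAY in `b`: `|b| ‖F_Φ(b)‖ ≤ ‖F*_{q_d Φ}‖₁`. [cite: Weil1965, Chap. III n° 37 Prop. 6, p. 54] -/
theorem abs_mul_norm_quadFibreDensity_le (d : ι → ℝ) {Φ : EuclideanSpace ℝ ι → ℂ} (hΦ : Integrable Φ)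
    (hG : Integrable (quadGaussTransform d Φ))
    (hΦq : Integrable fun v => (quadFormDiag d v : ℂ) * Φ v)
    (hGq : Integrable (quadGaussTransform d fun v => (quadFormDiag d v : ℂ) * Φ v)) (b : ℝ) :
    |b| * ‖quadFibreDensity d Φ b‖ ≤ ∫ t, ‖quadGaussTransform d (fun v => (quadFormDiag d v : ℂ) * Φ v) t‖ := by
  have h := ofReal_mul_quadFibreDensity d hΦ hG hΦq hGq b
  have hn : |b| * ‖quadFibreDensity d Φ b‖ = ‖(b : ℂ) * quadFibreDensity d Φ b‖ := by
    rw [norm_mul, Complex.norm_real, Real.norm_eq_abs]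
  rw [hn, h]
  exact norm_quadFibreDensity_le d _ b

/-- INTEGRABILITY of `F_Φ` («intégrables») from two multiplications by the form:
`‖F_Φ(b)‖ ≤ (‖F*_Φ‖₁ + ‖F*_{q² Φ}‖₁) (1 + b²)⁻¹`. [cite: Weil1965, Chap. III n° 37 Prop. 6, p. 54] -/
theorem integrable_quadFibreDensity (d : ι → ℝ) {Φ : EuclideanSpace ℝ ι → ℂ} (hΦ : Integrable Φ)
    (hG : Integrable (quadGaussTransform d Φ))
    (hΦq : Integrable fun v => (quadFormDiag d v : ℂ) * Φ v)
    (hGq : Integrable (quadGaussTransform d fun v => (quadFormDiag d v : ℂ) * Φ v))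
    (hΦqq : Integrable fun v => (quadFormDiag d v : ℂ) * ((quadFormDiag d v : ℂ) * Φ v))
    (hGqq : Integrable (quadGaussTransform d fun v => (quadFormDiag d v : ℂ) * ((quadFormDiag d v : ℂ) * Φ v))) :
    Integrable (quadFibreDensity d Φ) := by
  set A₀ : ℝ := ∫ t, ‖quadGaussTransform d Φ t‖
  set A₂ : ℝ := ∫ t, ‖quadGaussTransform d (fun v => (quadFormDiag d v : ℂ) * ((quadFormDiag d v : ℂ) * Φ v)) t‖
  have hA₀ : 0 ≤ A₀ := integral_nonneg fun _ => norm_nonneg _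
  have hA₂ : 0 ≤ A₂ := integral_nonneg fun _ => norm_nonneg _
  have hbound : ∀ b : ℝ, ‖quadFibreDensity d Φ b‖ ≤ (A₀ + A₂) * (1 + b ^ 2)⁻¹ := fun b => by
    have h0 : ‖quadFibreDensity d Φ b‖ ≤ A₀ := norm_quadFibreDensity_le d Φ b
    -- `b² F_Φ(b) = F_{q² Φ}(b)`
    have h2 : b ^ 2 * ‖quadFibreDensity d Φ b‖ ≤ A₂ := by
      have e1 := ofReal_mul_quadFibreDensity d hΦ hG hΦq hGq b
      have e2 := ofReal_mul_quadFibreDensity d hΦq hGq hΦqq hGqq b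
      have : ((b ^ 2 : ℝ) : ℂ) * quadFibreDensity d Φ b =
          quadFibreDensity d (fun v => (quadFormDiag d v : ℂ) * ((quadFormDiag d v : ℂ) * Φ v)) b := by
        rw [← e2, ← e1]; push_cast; ring
      have hn : b ^ 2 * ‖quadFibreDensity d Φ b‖ = ‖((b ^ 2 : ℝ) : ℂ) * quadFibreDensity d Φ b‖ := by
        rw [norm_mul, Complex.norm_real, Real.norm_eq_abs, abs_of_nonneg (sq_nonneg b)]
      rw [hn, this]
      exact norm_quadFibreDensity_le d _ b
    have hpos : 0 < 1 + b ^ 2 := by positivity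
    rw [le_mul_inv_iff₀ hpos]
    nlinarith
  refine Integrable.mono' ((integrable_inv_one_add_sq).const_mul (A₀ + A₂))
    (continuous_quadFibreDensity d hG).aestronglyMeasurable (ae_of_all _ hbound)

/-! ## §4 The Fourier pair `F*_Φ = 𝓕⁻ F_Φ` -/

/-- **`F_Φ` and `F*_Φ` are Fourier transforms of each other**: `𝓕⁻ F_Φ = F*_Φ` as soon as both are integrable.
[cite: Weil1965, Chap. III n° 37 Prop. 6, p. 54] -/
theorem fourierInv_quadFibreDensity (d : ι → ℝ) {Φ : EuclideanSpace ℝ ι → ℂ} (hΦ : Integrable Φ)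
    (hG : Integrable (quadGaussTransform d Φ)) (hF : Integrable (quadFibreDensity d Φ)) :
    𝓕⁻ (quadFibreDensity d Φ) = quadGaussTransform d Φ :=
  (continuous_quadGaussTransform d hΦ).fourierInv_fourier_eq hG hF

/-- the pair, pointwise: `F*_Φ(t) = ∫ e^{2πi b t} F_Φ(b) db`, i.e. `∫ Φ(v) e^{2πi t q_d(v)} dv` is the (inverse)
Fourier transform of the fibre density. [cite: Weil1965, Chap. III n° 37 Prop. 6, p. 54] -/
theorem quadGaussTransform_eq_integral_fourierChar_smul (d : ι → ℝ) {Φ : EuclideanSpace ℝ ι → ℂ}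
    (hΦ : Integrable Φ) (hG : Integrable (quadGaussTransform d Φ)) (hF : Integrable (quadFibreDensity d Φ))
    (t : ℝ) : quadGaussTransform d Φ t = ∫ b, 𝐞 (b * t) • quadFibreDensity d Φ b := by
  rw [← fourierInv_quadFibreDensity d hΦ hG hF, Real.fourierInv_eq]
  congr 1 with b
  simp [mul_comm]

/-- `F*_Φ(0) = ∫ Φ`. [cite: Weil1965, Chap. I n° 1 (1), p. 3] -/
theorem quadGaussTransform_zero (d : ι → ℝ) (Φ : EuclideanSpace ℝ ι → ℂ) :
    quadGaussTransform d Φ 0 = ∫ v, Φ v := by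
  rw [quadGaussTransform_apply]
  congr 1 with v
  rw [quadChar_apply]
  simp

/-- «en particulier, on a `∫ Φ dx = ∫ F_Φ di`»: the total mass of the push-forward.
[cite: Weil1965, Chap. III n° 37 Prop. 6, p. 54] -/
theorem integral_quadFibreDensity (d : ι → ℝ) {Φ : EuclideanSpace ℝ ι → ℂ} (hΦ : Integrable Φ)
    (hG : Integrable (quadGaussTransform d Φ)) (hF : Integrable (quadFibreDensity d Φ)) :
    ∫ b, quadFibreDensity d Φ b = ∫ v, Φ v := by
  rw [← quadGaussTransform_zero d Φ, quadGaussTransform_eq_integral_fourierChar_smul d hΦ hG hF 0]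
  congr 1 with b
  simp

end Literature.NumberTheory.Weil1965
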